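import Literature.NumberTheory.LFunctions.MertensCertificate

/-!
# Certified Odlyzko–te Riele computation, block 07: zeros 701–800

One compiled evaluation (`native_decide`) of `Literature.ZetaNumerics.Mertens.checkChunk 7`; see
`Literature/NumberTheory/LFunctions/MertensCertificate.lean` for the checker, its soundness
theorem `checkChunk_sound`, and the meaning of the data. In words: for each of the zeros
`j = 700, …, 799` (0-indexed) the claimed bracket `[a_j, a_j + 1] · 2^{-240}` is well ordered,
the twisted sign test certifies a zero of `ζ` on the critical line inside it (two certified
90-digit evaluations of `ζ(½ + it)` by the Euler–Maclaurin formula), and the enclosures of the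
summands `2 Re [k(γ) e^{iγy} / (ρ ζ'(ρ))]` at `y₊`, `y₋` add up within the claimed block
bounds `(L_7, U_7)`. The only non-standard axiom of this file is the `native_decide` auxiliary
axiom of `checkChunk_07` (trust in the Lean compiler, the `Lean.ofReduceBool` /
`Lean.trustCompiler` family), declared to the gate as `computational`.
-/

namespace Literature.NumberTheory.LFunctions.MertensCertificate.ZetaNumerics.Mertens

/-- Block 07 of the certified computation behind [OdlyzkoTeRiele1985, §4.2–4.3, Table 3]:
`checkChunk 7 = true`. [cite: OdlyzkoTeRiele1985, §4.3 Table 3 (lines 15, 21) p. 155] -/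
theorem checkChunk_07 : ZetaNumerics.Mertens.checkChunk 7 = true := by
  native_decide

end Literature.NumberTheory.LFunctions.MertensCertificate.ZetaNumerics.Mertens
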